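import Summits.BirchSwinnertonDyer.BirchSwinnertonDyer.Theorems.ManinLocalTwoThreeBoundaryAnnihilator
import HarnessLib

/-!
# Base change of degree-`0` cocycles along `K → K̄` (generalised Hecke eigenclasses stay generalised eigenclasses), and
# PARABOLICITY over algebraically closed fields ⟹ the hypothesis (PAR) of the E-es-25 assembly ⟹ the leaf

Summit `BirchSwinnertonDyer`, route `ManinLocalTwoThree` (cell bsd-f2-manin), cruxes C2 `ManinOddAtFour`
(stmt-BirchSwinnertonDyer-22967) / C3 `ManinPrimeToThreeAtNine` (stmt-BirchSwinnertonDyer-22968); registered stubs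
`stub_relativeIharaBarTwo` / `stub_relativeIharaBar331` = leaf E-es-25, which `relativeIharaShiftVanishingBar_of_parabolic`
(p3, `Theorems/ManinLocalTwoThreeBoundaryAnnihilator.lean`) derives from PARABOLICITY of non-Eisenstein generalised eigenclasses,
stated over the leaf's field `K` with the non-Eisenstein condition read in `K̄ = AlgebraicClosure K`.  The seat proving
PARABOLICITY (p2 `parabolic_of_isHeckeGenEigenvector`, the `∂`-twin of E-es-30) works over an ALGEBRAICALLY CLOSED field.
This file is the adapter:

* §1 `heckeU_baseChange`, `coe_pow_sub_heckeUZ`, `exists_cocycle_baseChange` — the cochain `γ ↦ ι(u γ)` is a cocycle over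
  `K'`, `heckeU` commutes with `ι`, and generalised eigen-ness for `λ` transports to generalised eigen-ness for `ι ∘ λ`
  (`isHeckeGenEigenvector_baseChange`);
* §2 `parabolicHyp_of_algClosed` — PARABOLICITY over algebraically closed fields (hypothesis, in the announced shape
  «`IsHeckeGenEigenvector S lam u`, `¬ IsEisensteinEigensystem 2 lam`, `S ⊇ primes L` ⟹ `u` kills every cusp-fixer») implies the
  hypothesis (PAR) of the assembly; hence `relativeIharaShiftVanishingBar_of_parabolic_algClosed : … → RelativeIharaShiftVanishingBar p t n`.

Nothing about BSD or Manin's conjecture is proved here.  References: HOME/MEMO-es.md §22.2 (0), §23 (cell bsd-f2-manin).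
-/

set_option autoImplicit false
set_option linter.dupNamespace false

open scoped MatrixGroups

open CongruenceSubgroup Matrix.SpecialLinearGroup Literature.NumberTheory.EllipticCurves.ModularForms
  Literature.NumberTheory.EllipticCurves.ModularForms.HidaCohomology
  Summit.BirchSwinnertonDyer.Rank1Residual.ManinAdditive

namespace Summit.BirchSwinnertonDyer.BirchSwinnertonDyer.Theorems.ManinLocalTwoThree

noncomputable section

/-! ### §1  Base change of cocycles -/

section BaseChange

variable {K K' : Type*} [Field K] [Field K'] (ι : K →+* K') {L : ℕ}

/-- `heckeU` (degree `0`) commutes with base change of the values. [folklore] -/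
theorem heckeU_baseChange {ℓ : ℕ} [NeZero ℓ] (hℓ : ℓ.Prime) (v : Gamma0 L → Fin 1 → K) :
    heckeU 0 L K' hℓ (fun γ i => ι (v γ i)) = fun γ i => ι (heckeU 0 L K hℓ v γ i) := by
  funext γ i
  rw [heckeU_apply, heckeU_apply, Finset.sum_apply, Finset.sum_apply, map_sum]
  refine Finset.sum_congr rfl fun j _ => ?_
  rw [act_zero_eq_id, act_zero_eq_id, LinearMap.id_apply, LinearMap.id_apply]

/-- Powers of `heckeU − μ` commute with base change of the values. [folklore] -/
theorem pow_sub_heckeU_baseChange {ℓ : ℕ} [NeZero ℓ] (hℓ : ℓ.Prime) (μ : K) (m : ℕ) (v : Gamma0 L → Fin 1 → K) :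
    ((heckeU 0 L K' hℓ - ι μ • (1 : Module.End K' (Gamma0 L → Fin 1 → K'))) ^ m) (fun γ i => ι (v γ i)) =
      fun γ i => ι (((heckeU 0 L K hℓ - μ • (1 : Module.End K (Gamma0 L → Fin 1 → K))) ^ m) v γ i) := by
  induction m generalizing v with
  | zero => rfl
  | succ m ih =>
    rw [pow_succ, Module.End.mul_apply, pow_succ, Module.End.mul_apply]
    have e : (heckeU 0 L K' hℓ - ι μ • (1 : Module.End K' (Gamma0 L → Fin 1 → K'))) (fun γ i => ι (v γ i)) =
        fun γ i => ι ((heckeU 0 L K hℓ - μ • (1 : Module.End K (Gamma0 L → Fin 1 → K))) v γ i) := by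
      rw [LinearMap.sub_apply, LinearMap.smul_apply, Module.End.one_apply, heckeU_baseChange]
      funext γ i
      simp only [Pi.sub_apply, Pi.smul_apply, smul_eq_mul, LinearMap.sub_apply, LinearMap.smul_apply,
        Module.End.one_apply, map_sub, map_mul]
    rw [e, ih]

/-- The cochain of `(heckeUZ − μ)^m u` is `(heckeU − μ)^m` of the cochain of `u`. [folklore] -/
theorem coe_pow_sub_heckeUZ {R : Type*} [Field R] {ℓ : ℕ} [NeZero ℓ] (hℓ : ℓ.Prime) (μ : R) (m : ℕ) (u : cocycles 0 L R) :
    ((((heckeUZ 0 L R hℓ - μ • (1 : Module.End R (cocycles 0 L R))) ^ m) u : cocycles 0 L R) : Gamma0 L → Fin 1 → R) =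
      ((heckeU 0 L R hℓ - μ • (1 : Module.End R (Gamma0 L → Fin 1 → R))) ^ m) (u : Gamma0 L → Fin 1 → R) := by
  have inner : ∀ v : cocycles 0 L R,
      (((heckeUZ 0 L R hℓ - μ • (1 : Module.End R (cocycles 0 L R))) v : cocycles 0 L R) : Gamma0 L → Fin 1 → R) =
        (heckeU 0 L R hℓ - μ • (1 : Module.End R (Gamma0 L → Fin 1 → R))) (v : Gamma0 L → Fin 1 → R) := by
    intro v
    rw [LinearMap.sub_apply, LinearMap.smul_apply, Module.End.one_apply, Submodule.coe_sub, Submodule.coe_smul,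
      coe_heckeUZ, LinearMap.sub_apply, LinearMap.smul_apply, Module.End.one_apply]
  induction m generalizing u with
  | zero => rfl
  | succ m ih =>
    rw [pow_succ, Module.End.mul_apply, pow_succ, Module.End.mul_apply, ih, inner]

/-- **Base change of a generalised Hecke eigen-cocycle**: the cochain `γ ↦ ι(u γ)` is a cocycle over `K'` and a generalised
eigenvector for the system `ι ∘ λ`. [folklore] -/
theorem exists_cocycle_baseChange (S : Finset ℕ) (lam : ℕ → K) (u : cocycles 0 L K) (hu : IsHeckeGenEigenvector S lam u) :
    ∃ u' : cocycles 0 L K', (u' : Gamma0 L → Fin 1 → K') = (fun γ i => ι ((u : Gamma0 L → Fin 1 → K) γ i)) ∧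
      IsHeckeGenEigenvector S (fun ℓ => ι (lam ℓ)) u' := by
  have hmem : (fun γ i => ι ((u : Gamma0 L → Fin 1 → K) γ i)) ∈ cocycles 0 L K' := by
    rw [mem_cocycles_iff]
    intro γ δ
    funext i
    have h := congrFun ((mem_cocycles_iff.mp u.2) γ δ) i
    simp only [act_zero_eq_id, LinearMap.id_apply, Pi.add_apply] at h ⊢
    rw [h, map_add]
  refine ⟨⟨_, hmem⟩, rfl, ?_⟩
  intro ℓ _ hℓ hℓS
  rw [Module.End.mem_maxGenEigenspace]
  obtain ⟨m, hm⟩ := (Module.End.mem_maxGenEigenspace _ _ _).1 (hu ℓ hℓ hℓS)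
  refine ⟨m, ?_⟩
  apply Subtype.ext
  rw [coe_pow_sub_heckeUZ, Submodule.coe_zero]
  show ((heckeU 0 L K' hℓ - ι (lam ℓ) • 1) ^ m) (fun γ i => ι ((u : Gamma0 L → Fin 1 → K) γ i)) = 0
  rw [pow_sub_heckeU_baseChange ι hℓ (lam ℓ) m, ← coe_pow_sub_heckeUZ hℓ (lam ℓ) m u, hm]
  funext γ i
  simp

end BaseChange

/-! ### §2  PARABOLICITY over algebraically closed fields ⟹ (PAR) ⟹ the leaf -/

/-- **(PAR) from PARABOLICITY over algebraically closed fields.**  If over every algebraically closed field a generalised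
`λ`-eigen cocycle (`ℓ ∉ S ⊇ primes L`) with `λ` NOT Eisenstein kills every cusp-fixing `γ ∈ Γ₀(L)`, then the hypothesis (PAR) of
`relativeIharaShiftVanishingBar_of_parabolic` holds (base change `u ↦ ι ∘ u`, `ι : K → K̄` injective). [folklore] -/
theorem parabolicHyp_of_algClosed (p t : ℕ)
    (h : ∀ (K : Type) [Field K] [IsAlgClosed K] (L : ℕ) [NeZero L] (S : Finset ℕ),
      (∀ q : ℕ, q.Prime → q ∣ L → q ∈ S) → ∀ (lam : ℕ → K) (u : cocycles 0 L K),
      IsHeckeGenEigenvector S lam u → ¬ IsEisensteinEigensystem 2 lam →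
      ∀ γ : Gamma0 L, ∀ c : OnePoint ℚ, mapGL ℚ (γ : SL(2, ℤ)) • c = c → (u : Gamma0 L → Fin 1 → K) γ = 0) :
    ∀ (K : Type) [Field K] [CharP K p] (L : ℕ) [NeZero L] (S : Finset ℕ) (lam : ℕ → K) (u : cocycles 0 L K),
      (∀ q : ℕ, q.Prime → q ∣ p * t * L → q ∈ S) → IsHeckeGenEigenvector S lam u →
      IsEisensteinEigensystem 2 (fun ℓ => algebraMap K (AlgebraicClosure K) (lam ℓ)) ∨
        ∀ γ : Gamma0 L, ∀ c : OnePoint ℚ, mapGL ℚ (γ : SL(2, ℤ)) • c = c → (u : Gamma0 L → Fin 1 → K) γ 0 = 0 := by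
  intro K _ _ L _ S lam u hS hu
  rw [or_iff_not_imp_left]
  intro hne γ c hc
  obtain ⟨u', hu', hgen⟩ := exists_cocycle_baseChange (algebraMap K (AlgebraicClosure K)) S lam u hu
  have h0 := h (AlgebraicClosure K) L S (fun q hq hqL => hS q hq (dvd_mul_of_dvd_right hqL _)) _ u' hgen hne γ c hc
  have h1 := congrFun h0 0
  rw [hu'] at h1
  simp only [Pi.zero_apply] at h1
  exact (algebraMap K (AlgebraicClosure K)).injective (by rw [h1, map_zero])

/-- **THE LEAF from PARABOLICITY over algebraically closed fields.** [folklore] -/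
theorem relativeIharaShiftVanishingBar_of_parabolic_algClosed {p t n : ℕ}
    (h : ∀ (K : Type) [Field K] [IsAlgClosed K] (L : ℕ) [NeZero L] (S : Finset ℕ),
      (∀ q : ℕ, q.Prime → q ∣ L → q ∈ S) → ∀ (lam : ℕ → K) (u : cocycles 0 L K),
      IsHeckeGenEigenvector S lam u → ¬ IsEisensteinEigensystem 2 lam →
      ∀ γ : Gamma0 L, ∀ c : OnePoint ℚ, mapGL ℚ (γ : SL(2, ℤ)) • c = c → (u : Gamma0 L → Fin 1 → K) γ = 0) :
    RelativeIharaShiftVanishingBar p t n :=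
  relativeIharaShiftVanishingBar_of_parabolic (parabolicHyp_of_algClosed p t h)

/-- **THE LEAF from PARABOLICITY over arbitrary fields with the `K̄`-read non-Eisenstein condition** (p1's announced shape
`parabolic_of_isHeckeGenEigenvector_of_not_isEisenstein`). [folklore] -/
theorem relativeIharaShiftVanishingBar_of_parabolic_bar {p t n : ℕ}
    (h : ∀ (L : ℕ) [NeZero L] (K : Type) [Field K] (S : Finset ℕ),
      (∀ q : ℕ, q.Prime → q ∣ L → q ∈ S) → ∀ (lam : ℕ → K) (u : cocycles 0 L K),
      IsHeckeGenEigenvector S lam u → ¬ IsEisensteinEigensystem 2 (fun ℓ => algebraMap K (AlgebraicClosure K) (lam ℓ)) →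
      ∀ γ : Gamma0 L, ∀ c : OnePoint ℚ, mapGL ℚ (γ : SL(2, ℤ)) • c = c → (u : Gamma0 L → Fin 1 → K) γ = 0) :
    RelativeIharaShiftVanishingBar p t n :=
  relativeIharaShiftVanishingBar_of_parabolic fun K _ _ L _ S lam u hS hu => by
    rw [or_iff_not_imp_left]
    intro hne γ c hc
    exact congrFun (h L K S (fun q hq hqL => hS q hq (dvd_mul_of_dvd_right hqL _)) lam u hu hne γ c hc) 0

end

end Summit.BirchSwinnertonDyer.BirchSwinnertonDyer.Theorems.ManinLocalTwoThree
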